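import Literature.AlgebraicGeometry.Motives.AbelianVarietyInducedActionTwistedMackey
import HarnessLib

/-!
# Twisted Mackey for the `L`-isotypical components of `Res_L Ind_H^G Y` and their Frobenius over a finite field:
# `|H| · Σ_{l ∈ L} c_W(l) Tr(Φ ρ(l) | T_ℓ X) = Σ_{x} Σ_{h ∈ H} Σ_{l ∈ L, l = xhx⁻¹} c_W(l) Tr(φ α(h) | T_ℓ Y)` and
# `|H| · |L| · Tr(π^m | T_ℓ B_W^L(Res_L Ind_H^G Y)) = Σ_x Σ_h Σ_{l = xhx⁻¹} c_W(l) τ_m^Y(h)`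

`X = ⊕_{t ∈ T} Y_t = Ind_H^G (Y, α)` (bicone `b`, `Σ_t π_t ≫ ι_t = 𝟙`; `ρ : G → End X`, `ι_t ρ(g) π_u = 0` for `u ≠ g t`; `T` transitive,
`H = Stab(t₀)`, `α(h) = ι_{t₀} ρ(h) π_{t₀}`), `L ≤ G`, and for `W ∈ Irr_ℚ(L)` the integral projector data `|L| e_W = Σ_{l} c_W(l) l`,
`u_W = Σ_{l ∈ L} c_W(l) ρ(l)`, `B_W^L(Res_L X) = Im u_W` (`Motives/AbelianVarietyInducedActionMackeyIsotypical`).  With a DIAGONAL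
`G`-ENDOMORPHISM `Φ = ⊕ φ` inserted (`Motives/AbelianVarietyInducedActionTwistedCharacter`, `…TwistedMackey`) — over a finite
field the Frobenius `π_X^m = ⊕ π_Y^m` — this file proves (theorems only, no definition):

* §1 **`|H| · Σ_{l ∈ L} c_W(l) Tr(Φ ρ(l) | T_ℓ X) = Σ_{x ∈ G} Σ_{h ∈ H} Σ_{l ∈ L, l = xhx⁻¹} c_W(l) Tr(φ α(h) | T_ℓ Y)`** (the twisted
  Mackey formula with the weight `c_W` extended by zero; any field, `ℓ` invertible);
* §2 over a FINITE FIELD `𝔽_q`, `ℓ ∤ q`: **`|H| · |L| · Tr(T_ℓ(π_{B_W^L(Res_L X)})^m) = Σ_x Σ_{h ∈ H} Σ_{l ∈ L, l = xhx⁻¹} c_W(l) · τ_m^Y(h)`**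
  with `τ_m^Y(h) = Tr(T_ℓ α(h) ∘ T_ℓ(π_Y)^m)` (the tree's `|L| Tr(π_{B_W}^m) = Σ_l c_W(l) τ_m^X(l)` for `ρ|_L`,
  `Motives/AbelianVarietyFactorFrobeniusTraces`, and §1): the Frobenius — hence the zeta function — of every `L`-isotypical
  piece of the restriction of an induced variety from the `H`-twisted Frobenius traces of `Y` (e.g. the Prym pieces of the
  intermediate quotients of a curve with `G`-action); at `m = 0` the dimension formula of `…MackeyIsotypical`.

## References

* [SerreLinearRepresentations1977] J.-P. Serre, *Linear Representations of Finite Groups*, GTM 42 (1977): §2.6 Thm. 8, §3.3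
  Thm. 12, §7.3 Prop. 22.  Held: `book:serre1977-linear-representations-finite-groups`, PDF pp. 30–31, 50–54 read 2026-08-28.
* [LangeRodriguez2022] H. Lange, R. E. Rodríguez, *Decomposition of Jacobians by Prym Varieties*, LNM 2310 (2022), §2.9.1
  Thm. 2.9.1, Prop. 2.9.3 (PDF pp. 43, 46), §3.5.
* [DokchitserEtAl2022] V. Dokchitser, H. Green, A. Konstantinou, A. Morgan, *Parity of ranks of Jacobians of curves*,
  arXiv:2211.06357, §3 and proof of Thm. 8.4.
* [Milne1986AbelianVarieties] J. S. Milne, *Abelian varieties*, in Cornell–Silverman (1986), §19, proof of Thm. 19.1 (pp. 144–145).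
* [MumfordAV1970] D. Mumford, *Abelian Varieties* (1970), §19 Thm. 3 (p. 176), Thm. 4 (p. 180).
-/

noncomputable section

open CategoryTheory CategoryTheory.Limits MulAction
open Literature.NumberTheory.DiophantineGeometry
open Literature.RepresentationTheory.FiniteGroups

universe u

namespace Literature.AlgebraicGeometry.Motives

namespace AbelianVariety

namespace Imprimitive

variable {K : Type u} [Field K]

/-! ## §1 The twisted Mackey formula with the weight `c_W` -/

section Twisted

variable (ℓ : ℕ) [Fact ℓ.Prime] {Y : AbelianVariety K} {T : Type} [Fintype T] (b : Bicone (fun _ : T ↦ Y))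
  {G : Type} [Group G] [Fintype G] [MulAction G T] [IsPretransitive G T] (ρ : G →* End b.pt) (t₀ : T)
  [Fintype (stabilizer G t₀)] (α : stabilizer G t₀ →* End Y) (L : Subgroup G) [Fintype L] [DecidableEq G]
  {Φ : b.pt ⟶ b.pt} {φ : Y ⟶ Y} (cW : L → ℤ)

/-- **Twisted Mackey with a weight on `L`**: for `c_W : L → ℤ` and a diagonal `G`-endomorphism `Φ = ⊕ φ`,
**`|H| · Σ_{l ∈ L} c_W(l) Tr(Φ ρ(l) | T_ℓ X) = Σ_{x ∈ G} Σ_{h ∈ H} Σ_{l ∈ L, l = xhx⁻¹} c_W(l) Tr(φ α(h) | T_ℓ Y)`** (the prequel's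
twisted Mackey formula for the weight `c_W` extended by zero to `G`). [cite: SerreLinearRepresentations1977, §7.3 Prop. 22 and §3.3 Thm. 12]
[cite: MumfordAV1970, §19 Thm. 4 (p. 180)] -/
theorem card_stabilizer_mul_sum_subgroup_weight_mul_trace_comp_eq (hb : ∑ t, b.π t ≫ b.ι t = 𝟙 b.pt)
    (hρ : ∀ (g : G) (t u : T), g • t ≠ u → b.ι t ≫ End.asHom (ρ g) ≫ b.π u = 0)
    (hΦ : ∀ t, b.ι t ≫ Φ = φ ≫ b.ι t) (hΦρ : ∀ g : G, Φ ≫ End.asHom (ρ g) = End.asHom (ρ g) ≫ Φ) (hℓ : (ℓ : K) ≠ 0)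
    (hα : ∀ h : stabilizer G t₀, End.asHom (α h) = b.ι t₀ ≫ End.asHom (ρ h) ≫ b.π t₀) :
    (Fintype.card (stabilizer G t₀) : ℤ_[ℓ]) *
        ∑ l : L, (cW l : ℤ_[ℓ]) * LinearMap.trace ℤ_[ℓ] (b.pt.tateModule ℓ) (tateModuleMap ℓ (Φ ≫ End.asHom (ρ l))) =
      ∑ x : G, ∑ h : stabilizer G t₀, ∑ l : L, (if (l : G) = x * h * x⁻¹ then
        (cW l : ℤ_[ℓ]) * LinearMap.trace ℤ_[ℓ] (Y.tateModule ℓ) (tateModuleMap ℓ (φ ≫ End.asHom (α h))) else 0) := by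
  classical
  set c : G → ℤ_[ℓ] := fun g ↦ ∑ l : L, (if (l : G) = g then (cW l : ℤ_[ℓ]) else 0) with hc
  have hcl : ∀ l₀ : L, c l₀ = cW l₀ := fun l₀ ↦ by
    simp only [hc, SetLike.coe_eq_coe, Finset.sum_ite_eq', Finset.mem_univ, if_true]
  have h2 := card_stabilizer_mul_sum_subgroup_mul_trace_comp_eq ℓ b ρ t₀ α L hb hρ hΦ hΦρ hℓ hα c
  rw [Finset.sum_congr rfl fun (l : L) _ ↦ by rw [hcl l]] at h2
  rw [h2]
  refine Finset.sum_congr rfl fun x _ ↦ Finset.sum_congr rfl fun h _ ↦ ?_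
  split_ifs with hmem
  · simp only [hc, Finset.sum_mul, ite_mul, zero_mul]
  · symm
    exact Finset.sum_eq_zero fun l _ ↦ if_neg fun (hl : (l : G) = x * h * x⁻¹) ↦ hmem (hl ▸ l.2)

end Twisted

/-! ## §2 Finite field: the Frobenius of the `L`-isotypical components of `Res_L Ind_H^G Y` -/

section Frobenius

variable [Finite K] (ℓ : ℕ) [Fact ℓ.Prime] {Y : AbelianVariety K} {T : Type} [Fintype T] (b : Bicone (fun _ : T ↦ Y))
  {G : Type} [Group G] [Fintype G] [MulAction G T] [IsPretransitive G T] (ρ : G →* End b.pt) (t₀ : T)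
  [Fintype (stabilizer G t₀)] (α : stabilizer G t₀ →* End Y) (L : Subgroup G) [Fintype L] [DecidableEq G]
  {cL : ratCharIdempotents L → L → ℤ}
  (hcL : ∀ e : ratCharIdempotents L,
    (Fintype.card L : ℚ) • (e : MonoidAlgebra ℚ L) = ∑ l, (cL e l : ℚ) • MonoidAlgebra.of ℚ L l)
  {uL : ratCharIdempotents L → (b.pt ⟶ b.pt)} (huL : ∀ e, End.of (uL e) = ∑ l : L, cL e l • (ρ.comp L.subtype) l)

include hcL huL

/-- **The Frobenius of the `L`-isotypical components of `Res_L Ind_H^G Y`**: over a finite field `𝔽_q`, `ℓ ∤ q`, for every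
`W ∈ Irr_ℚ(L)` (`|L| e_W = Σ_l c_W(l) l`, `u_W = Σ_l c_W(l) ρ(l)`, `B_W^L = Im u_W`) and every `m`,
**`|H| · |L| · Tr(T_ℓ(π_{B_W^L})^m | T_ℓ B_W^L) = Σ_{x ∈ G} Σ_{h ∈ H} Σ_{l ∈ L, l = xhx⁻¹} c_W(l) · Tr(T_ℓ α(h) ∘ T_ℓ(π_Y)^m | T_ℓ Y)`**
(`|L| · Tr(π_{B_W}^m) = Σ_l c_W(l) τ_m^X(l)` for `ρ|_L` and the twisted Mackey formula for `Φ = π_X^m`, `φ = π_Y^m`): the zeta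
function of each `L`-isotypical piece of the restriction from `H`-twisted Frobenius traces of `Y`.
[cite: LangeRodriguez2022, §2.9.1 Prop. 2.9.3 (PDF p. 46) and §3.5] [cite: SerreLinearRepresentations1977, §7.3 Prop. 22]
[cite: DokchitserEtAl2022, §3 and proof of Thm. 8.4] [cite: Milne1986AbelianVarieties, §19, proof of Thm. 19.1 (pp. 144–145)] -/
theorem card_stabilizer_mul_card_mul_trace_frobeniusHom_pow_isotypical_restrict_eq_sum (hb : ∑ t, b.π t ≫ b.ι t = 𝟙 b.pt)
    (hρ : ∀ (g : G) (t u : T), g • t ≠ u → b.ι t ≫ End.asHom (ρ g) ≫ b.π u = 0) (hℓ : (ℓ : K) ≠ 0)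
    (hα : ∀ h : stabilizer G t₀, End.asHom (α h) = b.ι t₀ ≫ End.asHom (ρ h) ≫ b.π t₀) (e : ratCharIdempotents L)
    (m : ℕ) :
    (Fintype.card (stabilizer G t₀) : ℤ_[ℓ]) * (Fintype.card L : ℤ_[ℓ]) *
        LinearMap.trace ℤ_[ℓ] ((image (uL e)).tateModule ℓ) (tateModuleMap ℓ (frobeniusHom (image (uL e))) ^ m) =
      ∑ x : G, ∑ h : stabilizer G t₀, ∑ l : L, (if (l : G) = x * h * x⁻¹ then
        (cL e l : ℤ_[ℓ]) * LinearMap.trace ℤ_[ℓ] (Y.tateModule ℓ)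
          (tateModuleMap ℓ (End.asHom (α h)) ∘ₗ tateModuleMap ℓ (frobeniusHom Y) ^ m) else 0) := by
  -- `|L| · Tr(π_{B_W}^m) = Σ_l c_W(l) τ_m^X(l)` for the restricted action
  have h1 := card_mul_trace_frobeniusHom_pow_isotypical_eq_sum ℓ (ρ.comp L.subtype) hcL huL hℓ e m
  -- the twisted Mackey formula for `Φ = π_X^m`
  have h2 := card_stabilizer_mul_sum_subgroup_weight_mul_trace_comp_eq ℓ b ρ t₀ α L (cL e) hb hρ
    (Φ := ((End.of (frobeniusHom b.pt) ^ m : End b.pt) : b.pt ⟶ b.pt))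
    (φ := ((End.of (frobeniusHom Y) ^ m : End Y) : Y ⟶ Y))
    (fun t ↦ (frobeniusHom_pow_comp (b.ι t) m).symm) (fun g ↦ frobeniusHom_pow_comp (End.asHom (ρ g)) m) hℓ hα
  have e1 : ∀ l : L, LinearMap.trace ℤ_[ℓ] (b.pt.tateModule ℓ)
      (tateModuleMap ℓ (((End.of (frobeniusHom b.pt) ^ m : End b.pt) : b.pt ⟶ b.pt) ≫ End.asHom (ρ l))) =
      LinearMap.trace ℤ_[ℓ] (b.pt.tateModule ℓ)
        (tateModuleMap ℓ (End.asHom ((ρ.comp L.subtype) l)) ∘ₗ tateModuleMap ℓ (frobeniusHom b.pt) ^ m) := fun l ↦ by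
    rw [tateModuleMap_comp, tateModuleMap_end_pow]; rfl
  have e2 : ∀ h : stabilizer G t₀, LinearMap.trace ℤ_[ℓ] (Y.tateModule ℓ)
      (tateModuleMap ℓ (((End.of (frobeniusHom Y) ^ m : End Y) : Y ⟶ Y) ≫ End.asHom (α h))) =
      LinearMap.trace ℤ_[ℓ] (Y.tateModule ℓ) (tateModuleMap ℓ (End.asHom (α h)) ∘ₗ tateModuleMap ℓ (frobeniusHom Y) ^ m) :=
    fun h ↦ by rw [tateModuleMap_comp, tateModuleMap_end_pow]
  simp only [e1, e2] at h2
  rw [← h1, ← mul_assoc] at h2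
  exact h2

end Frobenius

end Imprimitive

end AbelianVariety

end Literature.AlgebraicGeometry.Motives
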